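import Mathlib
import Summits.MatrixMultiplication.MatrixMultiplication.Theses.SnSubsetDichotomy

/-!
# `stub_bandRelocation` (line `mover-covering-amgm`, crux `SnSubsetDichotomy.JuntaBranch`,
# stmt-MatrixMultiplication-8304) — level transfer of a super-neutral block; the near-band regime

The registered stub `stub_bandRelocation` of the line `mover-covering-amgm`
(`Cruxes/JuntaBranch/Lines/mover_covering_amgm.lean`) asserts: for `ε, c > 0` there is
`ε' ∈ (0, ε]` such that for `n ≥ n₀`, in a TPP triple `(S,T,U)` of `S_n` that is LARGE
(`(n!)^{3/2}e^{-c√n} ≤ |S||T||U|`) with partners `T, U` inclusion-saturated w.r.t. `S`, an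
`ε`-super-neutral block `(I → L)` of `S` (`n^{(1/2+ε)t}|S| < |S ∩ U_{I→L}|·n^{(t)}`) at a level
`1 ≤ t ≤ √n` OUTSIDE the band `[t_lo, t_hi] = [2n^{(1−ε')/2}, c√n/(ε' ln n + 2)]` forces
(a) an `ε'`-super-neutral block of some member `X ∈ {S,T,U}` at a level inside the band, or
(b) joint gain `e^{c+1}|S||T||U|((n−t)!/n!)^{3/2} ≤ |S_I||T_J||U_P|` at the bumped block itself.

This file (line `mover-covering-amgm`, stub worker, 2026-08-16) proves what LEVEL TRANSFER of
`S`'s own block gives, and reduces the stub to its deep regimes: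

* `exists_cons_atom`, `exists_atom_at_level_ge` — EXTENSION of a block by pigeonhole:
  `|X_I| ≤ (n−t)^{(t''−t)}·|X_{I''}|` for some injective extension to any level `t'' ∈ [t, n]`;
  as `n^{(t'')} = n^{(t)}(n−t)^{(t''−t)}`, the ratio `R_X(t) = max_{I,L} |X_I| n^{(t)}/|X|` is
  monotone in the level.  `card_atom_le_card_atom_restrict` — RESTRICTION only enlarges atoms.
* `superNeutral_up` / `superNeutral_down` — an `ε`-bump at level `t` is an `ε'`-bump at every
  level `t'' ∈ [t, t(1+2ε)/(1+2ε')]` and at every level `t' ∈ [t(1−2ε)/(1−2ε'), t]` (for `S`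
  alone these windows cannot be widened: a thin slice of `U_{I→L}` of relative mass
  `2n^{(ε−1/2)t}` on a bump-free bulk such as `S_{n/2} × S_{n/2}` attains them — the triage's
  "rigid isolated bump", not formalised here).
* `stub_bandRelocation_nearBand` — hence exit (a) with `X = S` whenever an integer band level is
  within reach: the stub holds (without TPP, largeness or partners) for bumped levels
  `t ∈ [⌈t_lo⌉(1+2ε')/(1+2ε), t_lo)` and `t ∈ (t_hi, ⌊t_hi⌋(1−2ε')/(1−2ε)]`.
* `stub_bandRelocation_of_deep` — the registered stub (verbatim signature) REDUCES to its deep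
  regimes (levels from `1` up to `≈ t_lo(1+2ε')/(1+2ε)`, and from `≈ t_hi(1−2ε')/(1−2ε)` up to
  `√n`), spelled as the hypothesis `hdeep`: the missing ingredient is a structure theorem on the
  PARTNERS next to a bump of `S` (low: partner isotropy at `S`'s target, or aggregation into a
  window block; high: no rigid isolated slices), for which the tree has no mechanism
  (`Theorems.JuntaBranch.exists_heavy_source_atom`, `R ≥ 1`, is the only partner lower bound), and
  whose exit (b) is load-bearing on `Large`: with `Large` deleted and the conclusion restricted to
  (b) the stub is false, by the level-1 family `(Stab(a), {(a x) : x < m}, {(a y) : y = a ∨ y ≥ m})`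
  of `S_{2m}` — TPP, partners inclusion-saturated, `R_S(a→a) = n`, all partner atoms at target `a`
  of size `≤ 1` (kernel-checked in the worker's companion work file
  `stub_bandRelocation_exitB_neg.lean`, theorem `bandRelocation_exitB_false_without_large`, kept
  with the line's evidence; not part of this file).
-/

open Literature.Combinatorics.Additive
open scoped Classical

set_option linter.dupNamespace false

namespace Summit.MatrixMultiplication.MatrixMultiplication.Theorems.JuntaBranch

/-- **Restriction of a block.** Restricting a block `(I → L)` of size `t` to its first `t'`
coordinates can only enlarge the atom: `X ∩ U_{I→L} ⊆ X ∩ U_{I'→L'}`. [folklore] -/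
theorem card_atom_le_card_atom_restrict {n t t' : ℕ} (X : Finset (Equiv.Perm (Fin n)))
    (I L : Fin t → Fin n) (h : t' ≤ t) :
    (X.filter (fun σ => ∀ k, σ (I k) = L k)).card ≤
      (X.filter (fun σ => ∀ k : Fin t', σ (I (Fin.castLE h k)) = L (Fin.castLE h k))).card := by
  refine Finset.card_le_card (fun σ hσ => ?_)
  simp only [Finset.mem_filter] at hσ ⊢
  exact ⟨hσ.1, fun k => hσ.2 _⟩

/-- **One-point extension of a block (pigeonhole).** For injective `I, L : Fin t → Fin n` with
`t < n` there are a fresh source `a ∉ range I` and a fresh target `b ∉ range L` such that the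
extended block `(a, I) → (b, L)` carries at least a `1/(n-t)` fraction of the atom at `(I → L)`:
every `σ` with `σ ∘ I = L` sends `a` outside `range L` (a set of `n - t` points). [folklore] -/
theorem exists_cons_atom {n t : ℕ} (X : Finset (Equiv.Perm (Fin n))) (I L : Fin t → Fin n)
    (hI : Function.Injective I) (hL : Function.Injective L) (htn : t < n) :
    ∃ a b : Fin n, Function.Injective (Fin.cons a I : Fin (t + 1) → Fin n) ∧
      Function.Injective (Fin.cons b L : Fin (t + 1) → Fin n) ∧
      (X.filter (fun σ => ∀ k, σ (I k) = L k)).card ≤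
        (n - t) * (X.filter (fun σ => ∀ k : Fin (t + 1),
          σ ((Fin.cons a I : Fin (t + 1) → Fin n) k) = (Fin.cons b L : Fin (t + 1) → Fin n) k)).card := by
  -- a fresh source point
  have hIim : (Finset.univ.image I).card = t := by
    rw [Finset.card_image_of_injective _ hI, Finset.card_univ, Fintype.card_fin]
  obtain ⟨a, ha⟩ : ∃ a : Fin n, a ∉ Finset.univ.image I := by
    by_contra hall
    push Not at hall
    have : (Finset.univ : Finset (Fin n)) ⊆ Finset.univ.image I := fun x _ => hall x
    have h2 := Finset.card_le_card this
    rw [hIim, Finset.card_univ, Fintype.card_fin] at h2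
    omega
  have ha' : a ∉ Set.range I := by
    rintro ⟨k, rfl⟩
    exact ha (Finset.mem_image_of_mem I (Finset.mem_univ k))
  -- the complement of the target block
  set B : Finset (Fin n) := Finset.univ \ Finset.univ.image L with hB
  have hLim : (Finset.univ.image L).card = t := by
    rw [Finset.card_image_of_injective _ hL, Finset.card_univ, Fintype.card_fin]
  have hBcard : B.card = n - t := by
    rw [hB, Finset.card_sdiff, Finset.card_univ, Fintype.card_fin, Finset.inter_univ, hLim]
  set A := X.filter (fun σ => ∀ k, σ (I k) = L k) with hA
  have hmaps : ∀ σ ∈ A, σ a ∈ B := by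
    intro σ hσ
    simp only [hA, Finset.mem_filter] at hσ
    simp only [hB, Finset.mem_sdiff, Finset.mem_univ, true_and, Finset.mem_image, not_exists]
    intro k hk
    apply ha'
    refine ⟨k, ?_⟩
    apply σ.injective
    rw [hσ.2 k, hk]
  have hBne : B.Nonempty := by
    rw [← Finset.card_pos, hBcard]
    omega
  obtain ⟨b, hbB, hbmax⟩ := B.exists_max_image (fun y => (A.filter (fun σ => σ a = y)).card) hBne
  have hb' : b ∉ Set.range L := by
    rintro ⟨k, rfl⟩
    simp only [hB, Finset.mem_sdiff, Finset.mem_univ, true_and, Finset.mem_image, not_exists] at hbB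
    exact hbB k rfl
  refine ⟨a, b, Fin.cons_injective_iff.mpr ⟨ha', hI⟩, Fin.cons_injective_iff.mpr ⟨hb', hL⟩, ?_⟩
  have hfib : A.filter (fun σ => σ a = b) =
      X.filter (fun σ => ∀ k : Fin (t + 1),
        σ ((Fin.cons a I : Fin (t + 1) → Fin n) k) = (Fin.cons b L : Fin (t + 1) → Fin n) k) := by
    ext σ
    simp only [hA, Finset.mem_filter, Fin.forall_fin_succ, Fin.cons_zero, Fin.cons_succ]
    tauto
  rw [← hfib, ← hBcard]
  calc A.card = ∑ y ∈ B, (A.filter (fun σ => σ a = y)).card :=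
        Finset.card_eq_sum_card_fiberwise hmaps
    _ ≤ ∑ _y ∈ B, (A.filter (fun σ => σ a = b)).card := Finset.sum_le_sum (fun y hy => hbmax y hy)
    _ = B.card * (A.filter (fun σ => σ a = b)).card := by rw [Finset.sum_const, smul_eq_mul]

/-- **Extension of a block to any higher level (iterated pigeonhole).** For injective
`I, L : Fin t → Fin n` and `t ≤ t'' ≤ n` there is an injective block `(I'' → L'')` of size `t''`
with `|X ∩ U_{I→L}| ≤ (n-t)^{(t''-t)} · |X ∩ U_{I''→L''}|`.  Since `n^{(t'')} = n^{(t)}(n-t)^{(t''-t)}`,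
the ratio `R_X(t) := max_{I,L} |X ∩ U_{I→L}|·n^{(t)}/|X|` is monotone in the level `t`. [folklore] -/
theorem exists_atom_at_level_ge {n t : ℕ} (X : Finset (Equiv.Perm (Fin n))) (I L : Fin t → Fin n)
    (hI : Function.Injective I) (hL : Function.Injective L) {t'' : ℕ} (ht : t ≤ t'')
    (htn : t'' ≤ n) :
    ∃ I'' L'' : Fin t'' → Fin n, Function.Injective I'' ∧ Function.Injective L'' ∧
      (X.filter (fun σ => ∀ k, σ (I k) = L k)).card ≤
        (n - t).descFactorial (t'' - t) * (X.filter (fun σ => ∀ k, σ (I'' k) = L'' k)).card := by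
  induction t'', ht using Nat.le_induction with
  | base => exact ⟨I, L, hI, hL, by simp⟩
  | succ m hm ih =>
    obtain ⟨I₁, L₁, hI₁, hL₁, h₁⟩ := ih (by omega)
    obtain ⟨a, b, hI₂, hL₂, h₂⟩ := exists_cons_atom X I₁ L₁ hI₁ hL₁ (by omega)
    refine ⟨_, _, hI₂, hL₂, ?_⟩
    have e : (n - t).descFactorial (m + 1 - t) = (n - t).descFactorial (m - t) * (n - m) := by
      rw [show m + 1 - t = (m - t) + 1 by omega, Nat.descFactorial_succ,
        show n - t - (m - t) = n - m by omega]
      ring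
    rw [e]
    calc _ ≤ (n - t).descFactorial (m - t) * (X.filter (fun σ => ∀ k, σ (I₁ k) = L₁ k)).card := h₁
      _ ≤ (n - t).descFactorial (m - t) * ((n - m) * (X.filter (fun σ => ∀ k : Fin (m + 1),
          σ ((Fin.cons a I₁ : Fin (m + 1) → Fin n) k) =
            (Fin.cons b L₁ : Fin (m + 1) → Fin n) k)).card) := Nat.mul_le_mul_left _ h₂
      _ = _ := by ring

/-- A super-neutral block forces `n ≥ 1` (for `n = 0` the level is `t = 0` and the inequality reads
`|X| < |X|`). [folklore] -/
theorem one_le_of_bump {n : ℕ} {ε : ℝ} {t : ℕ} {I L : Fin t → Fin n}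
    {X : Finset (Equiv.Perm (Fin n))}
    (hb : (n : ℝ) ^ ((1 / 2 + ε) * t) * (X.card : ℝ) <
      ((X.filter (fun σ => ∀ k, σ (I k) = L k)).card : ℝ) * (n.descFactorial t : ℝ)) :
    1 ≤ n := by
  by_contra h0
  push Not at h0
  have hn : n = 0 := by omega
  subst hn
  rcases Nat.eq_zero_or_pos t with rfl | ht
  · have hfil : ((X.filter (fun σ => ∀ k, σ (I k) = L k)).card : ℝ) ≤ X.card := by
      exact_mod_cast Finset.card_le_card (Finset.filter_subset _ _)
    simp only [CharP.cast_eq_zero, mul_zero, Real.rpow_zero, one_mul,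
      Nat.descFactorial_zero, Nat.cast_one, mul_one] at hb
    linarith
  · exact Fin.elim0 (I ⟨0, ht⟩)

/-- The level of an injective block is at most `n`. [folklore] -/
theorem level_le_of_injective {n t : ℕ} {L : Fin t → Fin n} (hL : Function.Injective L) : t ≤ n := by
  simpa using Fintype.card_le_of_injective L hL

/-- **Upward level transfer of super-neutrality.** An `ε`-super-neutral block of `X` at level `t`
yields an `ε''`-super-neutral block at every level `t'' ∈ [t, n]` with
`(1/2+ε'')t'' ≤ (1/2+ε)t` (i.e. `t'' ≤ t(1+2ε)/(1+2ε'')`): extend the block by pigeonhole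
(`exists_atom_at_level_ge`); the ratio `|X_I|·n^{(t)}/|X|` does not decrease. [folklore] -/
theorem superNeutral_up {n t t'' : ℕ} {ε ε'' : ℝ} (X : Finset (Equiv.Perm (Fin n)))
    (I L : Fin t → Fin n) (hI : Function.Injective I) (hL : Function.Injective L) (ht : t ≤ t'')
    (htn : t'' ≤ n) (hexp : (1 / 2 + ε'') * t'' ≤ (1 / 2 + ε) * t)
    (hb : (n : ℝ) ^ ((1 / 2 + ε) * t) * (X.card : ℝ) <
      ((X.filter (fun σ => ∀ k, σ (I k) = L k)).card : ℝ) * (n.descFactorial t : ℝ)) :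
    ∃ I'' L'' : Fin t'' → Fin n, Function.Injective I'' ∧ Function.Injective L'' ∧
      (n : ℝ) ^ ((1 / 2 + ε'') * t'') * (X.card : ℝ) <
        ((X.filter (fun σ => ∀ k, σ (I'' k) = L'' k)).card : ℝ) * (n.descFactorial t'' : ℝ) := by
  obtain ⟨I'', L'', hI'', hL'', hle⟩ := exists_atom_at_level_ge X I L hI hL ht htn
  refine ⟨I'', L'', hI'', hL'', ?_⟩
  have hn1 : (1 : ℝ) ≤ n := by exact_mod_cast one_le_of_bump hb
  have hD : ((n - t).descFactorial (t'' - t) : ℝ) * (n.descFactorial t : ℝ) =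
      (n.descFactorial t'' : ℝ) := by
    exact_mod_cast Nat.descFactorial_mul_descFactorial ht
  have hleR : ((X.filter (fun σ => ∀ k, σ (I k) = L k)).card : ℝ) ≤
      ((n - t).descFactorial (t'' - t) : ℝ) *
        ((X.filter (fun σ => ∀ k, σ (I'' k) = L'' k)).card : ℝ) := by
    exact_mod_cast hle
  have hpow : (n : ℝ) ^ ((1 / 2 + ε'') * t'') ≤ (n : ℝ) ^ ((1 / 2 + ε) * t) :=
    Real.rpow_le_rpow_of_exponent_le hn1 hexp
  have hX0 : (0 : ℝ) ≤ X.card := Nat.cast_nonneg _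
  have hD0 : (0 : ℝ) ≤ (n.descFactorial t : ℝ) := Nat.cast_nonneg _
  calc (n : ℝ) ^ ((1 / 2 + ε'') * t'') * (X.card : ℝ)
      ≤ (n : ℝ) ^ ((1 / 2 + ε) * t) * (X.card : ℝ) := mul_le_mul_of_nonneg_right hpow hX0
    _ < ((X.filter (fun σ => ∀ k, σ (I k) = L k)).card : ℝ) * (n.descFactorial t : ℝ) := hb
    _ ≤ ((n - t).descFactorial (t'' - t) : ℝ) *
        ((X.filter (fun σ => ∀ k, σ (I'' k) = L'' k)).card : ℝ) * (n.descFactorial t : ℝ) :=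
        mul_le_mul_of_nonneg_right hleR hD0
    _ = ((X.filter (fun σ => ∀ k, σ (I'' k) = L'' k)).card : ℝ) * (n.descFactorial t'' : ℝ) := by
        rw [← hD]; ring

/-- **Downward level transfer of super-neutrality.** An `ε`-super-neutral block `(I → L)` of `X`
at level `t` restricts to an `ε'`-super-neutral block at every level `t' ≤ t` with
`(1/2+ε')t' + (t − t') ≤ (1/2+ε)t` (i.e. `t' ≥ t(1−2ε)/(1−2ε')`): the atom only grows under
restriction and `n^{(t)} ≤ n^{t−t'}·n^{(t')}`. [folklore] -/
theorem superNeutral_down {n t t' : ℕ} {ε ε' : ℝ} (X : Finset (Equiv.Perm (Fin n)))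
    (I L : Fin t → Fin n) (hL : Function.Injective L) (ht : t' ≤ t)
    (hexp : (1 / 2 + ε') * t' + ((t : ℝ) - t') ≤ (1 / 2 + ε) * t)
    (hb : (n : ℝ) ^ ((1 / 2 + ε) * t) * (X.card : ℝ) <
      ((X.filter (fun σ => ∀ k, σ (I k) = L k)).card : ℝ) * (n.descFactorial t : ℝ)) :
    (n : ℝ) ^ ((1 / 2 + ε') * t') * (X.card : ℝ) <
      ((X.filter (fun σ => ∀ k : Fin t', σ (I (Fin.castLE ht k)) = L (Fin.castLE ht k))).card : ℝ) *
        (n.descFactorial t' : ℝ) := by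
  have hn1 : (1 : ℝ) ≤ n := by exact_mod_cast one_le_of_bump hb
  have hn0 : (0 : ℝ) < n := by linarith
  have htn : t ≤ n := level_le_of_injective hL
  -- D = n^{(t)} > 0 and D = (n - t')^{(t - t')} · D' ≤ n^{t - t'} · D'
  have hDpos : (0 : ℝ) < (n.descFactorial t : ℝ) := by
    exact_mod_cast Nat.descFactorial_pos.mpr htn
  have hDD : (n.descFactorial t : ℝ) ≤ (n : ℝ) ^ ((t : ℝ) - t') * (n.descFactorial t' : ℝ) := by
    have h1 : (n - t').descFactorial (t - t') * n.descFactorial t' = n.descFactorial t :=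
      Nat.descFactorial_mul_descFactorial ht
    have h2 : (n - t').descFactorial (t - t') ≤ n ^ (t - t') :=
      le_trans (Nat.descFactorial_le (t - t') (Nat.sub_le n t')) (Nat.descFactorial_le_pow n _)
    have h3 : n.descFactorial t ≤ n ^ (t - t') * n.descFactorial t' := by
      rw [← h1]; exact Nat.mul_le_mul_right _ h2
    have h4 : (n.descFactorial t : ℝ) ≤ ((n ^ (t - t') * n.descFactorial t' : ℕ) : ℝ) := by
      exact_mod_cast h3
    refine le_trans h4 (le_of_eq ?_)
    push_cast
    rw [← Real.rpow_natCast, Nat.cast_sub ht]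
  -- the atom only grows under restriction
  have hA : ((X.filter (fun σ => ∀ k, σ (I k) = L k)).card : ℝ) ≤
      ((X.filter (fun σ => ∀ k : Fin t', σ (I (Fin.castLE ht k)) = L (Fin.castLE ht k))).card : ℝ) := by
    exact_mod_cast card_atom_le_card_atom_restrict X I L ht
  -- exponents
  have hpow : (n : ℝ) ^ ((1 / 2 + ε') * t') * (n : ℝ) ^ ((t : ℝ) - t') ≤ (n : ℝ) ^ ((1 / 2 + ε) * t) := by
    rw [← Real.rpow_add hn0]
    exact Real.rpow_le_rpow_of_exponent_le hn1 hexp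
  have hX0 : (0 : ℝ) ≤ X.card := Nat.cast_nonneg _
  set A' := ((X.filter (fun σ => ∀ k : Fin t', σ (I (Fin.castLE ht k)) = L (Fin.castLE ht k))).card : ℝ)
    with hA'
  have hA'0 : 0 ≤ A' := Nat.cast_nonneg _
  have key : (n : ℝ) ^ ((1 / 2 + ε') * t') * (X.card : ℝ) * (n.descFactorial t : ℝ) <
      A' * (n.descFactorial t' : ℝ) * (n.descFactorial t : ℝ) := by
    calc (n : ℝ) ^ ((1 / 2 + ε') * t') * (X.card : ℝ) * (n.descFactorial t : ℝ)
        ≤ (n : ℝ) ^ ((1 / 2 + ε') * t') * (X.card : ℝ) *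
            ((n : ℝ) ^ ((t : ℝ) - t') * (n.descFactorial t' : ℝ)) :=
          mul_le_mul_of_nonneg_left hDD (by positivity)
      _ = (n : ℝ) ^ ((1 / 2 + ε') * t') * (n : ℝ) ^ ((t : ℝ) - t') * (X.card : ℝ) *
            (n.descFactorial t' : ℝ) := by ring
      _ ≤ (n : ℝ) ^ ((1 / 2 + ε) * t) * (X.card : ℝ) * (n.descFactorial t' : ℝ) := by
          gcongr
      _ < ((X.filter (fun σ => ∀ k, σ (I k) = L k)).card : ℝ) * (n.descFactorial t : ℝ) *
            (n.descFactorial t' : ℝ) := by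
          have hD'pos : (0 : ℝ) < (n.descFactorial t' : ℝ) := by
            exact_mod_cast Nat.descFactorial_pos.mpr (le_trans ht htn)
          exact mul_lt_mul_of_pos_right hb hD'pos
      _ ≤ A' * (n.descFactorial t : ℝ) * (n.descFactorial t' : ℝ) := by gcongr
      _ = A' * (n.descFactorial t' : ℝ) * (n.descFactorial t : ℝ) := by ring
  exact lt_of_mul_lt_mul_right key hDpos.le

/-- **`stub_bandRelocation` in the near-band regime — exit (a) with `X = S`, by level transfer
alone (no TPP, no largeness, no partners).**  If the bumped level `t` of `S` is within level-transfer
reach of an integer level `t'` of the band `[2n^{(1−ε')/2}, c√n/(ε' ln n + 2)]` (with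
`1 ≤ t' ≤ √n`) — upward, `t ≤ t'` and `(1/2+ε')t' ≤ (1/2+ε)t`, i.e. `t' ≤ t(1+2ε)/(1+2ε')`; or
downward, `t' ≤ t` and `(1/2+ε')t' + (t − t') ≤ (1/2+ε)t`, i.e. `t' ≥ t(1−2ε)/(1−2ε')` — then `S`
itself has an `ε'`-super-neutral block at level `t'`, which is exit (a) of the stub verbatim.  For
`n` large this covers the bumped levels `t ∈ [⌈t_lo⌉(1+2ε')/(1+2ε), t_lo)` just below and
`t ∈ (t_hi, ⌊t_hi⌋(1−2ε')/(1−2ε)]` just above the band; the deep regimes `t < t_lo(1+2ε')/(1+2ε)`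
(down to level `1`) and `t > t_hi(1−2ε')/(1−2ε)` (up to `√n`) are not reachable by level transfer
of `S`'s own block (a thin slice `P ⊆ U_{I→L}` on a bump-free bulk keeps every other level
sub-neutral), and are the open content of the stub (`stub_bandRelocation_of_deep`). [folklore] -/
theorem stub_bandRelocation_nearBand :
    ∀ ε ε' c : ℝ, ∀ n : ℕ, ∀ S T U : Finset (Equiv.Perm (Fin n)),
      ∀ t : ℕ, ∀ I L : Fin t → Fin n, Function.Injective I → Function.Injective L →
      (n : ℝ) ^ ((1 / 2 + ε) * t) * (S.card : ℝ) <
        ((S.filter (fun σ => ∀ k, σ (I k) = L k)).card : ℝ) * (n.descFactorial t : ℝ) →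
      ∀ t' : ℕ, 1 ≤ t' → (t' : ℝ) ≤ Real.sqrt (n : ℝ) → 2 * (n : ℝ) ^ ((1 - ε') / 2) ≤ (t' : ℝ) →
      (t' : ℝ) ≤ c * Real.sqrt (n : ℝ) / (ε' * Real.log (n : ℝ) + 2) →
      ((t ≤ t' ∧ (1 / 2 + ε') * t' ≤ (1 / 2 + ε) * t) ∨
        (t' ≤ t ∧ (1 / 2 + ε') * t' + ((t : ℝ) - t') ≤ (1 / 2 + ε) * t)) →
      ∃ X : Finset (Equiv.Perm (Fin n)), (X = S ∨ X = T ∨ X = U) ∧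
        ∃ t' : ℕ, 1 ≤ t' ∧ (t' : ℝ) ≤ Real.sqrt (n : ℝ) ∧ 2 * (n : ℝ) ^ ((1 - ε') / 2) ≤ (t' : ℝ) ∧
          (t' : ℝ) ≤ c * Real.sqrt (n : ℝ) / (ε' * Real.log (n : ℝ) + 2) ∧
          ∃ I' L' : Fin t' → Fin n, Function.Injective I' ∧ Function.Injective L' ∧
            (n : ℝ) ^ ((1 / 2 + ε') * t') * (X.card : ℝ) <
              ((X.filter (fun σ => ∀ k, σ (I' k) = L' k)).card : ℝ) * (n.descFactorial t' : ℝ) := by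
  intro ε ε' c n S T U t I L hI hL hb t' ht'1 ht'n hlo hhi hreach
  have hn1 : 1 ≤ n := one_le_of_bump hb
  have ht'le : t' ≤ n := by
    have h1 : (t' : ℝ) ≤ n := by
      refine le_trans ht'n ?_
      rw [Real.sqrt_le_left (by positivity)]
      have : (1 : ℝ) ≤ n := by exact_mod_cast hn1
      nlinarith
    exact_mod_cast h1
  rcases hreach with ⟨htt', hexp⟩ | ⟨ht't, hexp⟩
  · obtain ⟨I', L', hI', hL', hb'⟩ := superNeutral_up S I L hI hL htt' ht'le hexp hb
    exact ⟨S, Or.inl rfl, t', ht'1, ht'n, hlo, hhi, I', L', hI', hL', hb'⟩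
  · refine ⟨S, Or.inl rfl, t', ht'1, ht'n, hlo, hhi, fun k => I (Fin.castLE ht't k),
      fun k => L (Fin.castLE ht't k), hI.comp (Fin.castLE_injective ht't),
      hL.comp (Fin.castLE_injective ht't), ?_⟩
    exact superNeutral_down S I L hL ht't hexp hb


/-- **Reduction of `stub_bandRelocation` to its deep regimes.**  The registered stub follows from
the same statement with the extra hypothesis that NO integer band level `t'` (with `1 ≤ t' ≤ √n`)
is within level-transfer reach of the bumped level `t` (`stub_bandRelocation_nearBand` handles the
rest with exit (a), `X = S`).  The remaining "deep" statement — bumps of `S` at levels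
`t ≲ t_lo(1+2ε')/(1+2ε)` (down to level `1`) or `t ≳ t_hi(1−2ε')/(1−2ε)` (up to `√n`) in a Large TPP
triple with saturated partners force a band bump of some member or joint gain at the block — is
the open content (no mechanism in the tree supplies partner structure next to a bump of `S`, and
exit (b) needs `Large`: without it the level-1 family `(Stab(a), {(a x)}, {(a y)})` refutes (b),
see the module docstring). [folklore] -/
theorem stub_bandRelocation_of_deep
    (hdeep : ∀ ε : ℝ, 0 < ε → ∀ c : ℝ, 0 < c → ∃ ε' : ℝ, 0 < ε' ∧ ε' ≤ ε ∧ ∃ n₀ : ℕ, ∀ n ≥ n₀,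
      ∀ S T U : Finset (Equiv.Perm (Fin n)), TripleProductProperty S T U →
      (n.factorial : ℝ) ^ ((3 : ℝ) / 2) * Real.exp (-(c * Real.sqrt (n : ℝ))) ≤
        ((S.card * T.card * U.card : ℕ) : ℝ) →
      (∀ g ∉ T, ¬ TripleProductProperty S (insert g T) U) →
      (∀ g ∉ U, ¬ TripleProductProperty S T (insert g U)) →
      ∀ t : ℕ, 1 ≤ t → (t : ℝ) ≤ Real.sqrt (n : ℝ) →
      ((t : ℝ) < 2 * (n : ℝ) ^ ((1 - ε') / 2) ∨
        c * Real.sqrt (n : ℝ) / (ε' * Real.log (n : ℝ) + 2) < (t : ℝ)) →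
      -- DEEP: no integer band level is within level-transfer reach of `t`
      (∀ t' : ℕ, 1 ≤ t' → (t' : ℝ) ≤ Real.sqrt (n : ℝ) → 2 * (n : ℝ) ^ ((1 - ε') / 2) ≤ (t' : ℝ) →
        (t' : ℝ) ≤ c * Real.sqrt (n : ℝ) / (ε' * Real.log (n : ℝ) + 2) →
        ¬ ((t ≤ t' ∧ (1 / 2 + ε') * t' ≤ (1 / 2 + ε) * t) ∨
            (t' ≤ t ∧ (1 / 2 + ε') * t' + ((t : ℝ) - t') ≤ (1 / 2 + ε) * t))) →
      ∀ I L : Fin t → Fin n, Function.Injective I → Function.Injective L →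
      (n : ℝ) ^ ((1 / 2 + ε) * t) * (S.card : ℝ) <
        ((S.filter (fun σ => ∀ k, σ (I k) = L k)).card : ℝ) * (n.descFactorial t : ℝ) →
      (∃ X : Finset (Equiv.Perm (Fin n)), (X = S ∨ X = T ∨ X = U) ∧
          ∃ t' : ℕ, 1 ≤ t' ∧ (t' : ℝ) ≤ Real.sqrt (n : ℝ) ∧ 2 * (n : ℝ) ^ ((1 - ε') / 2) ≤ (t' : ℝ) ∧
            (t' : ℝ) ≤ c * Real.sqrt (n : ℝ) / (ε' * Real.log (n : ℝ) + 2) ∧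
            ∃ I' L' : Fin t' → Fin n, Function.Injective I' ∧ Function.Injective L' ∧
              (n : ℝ) ^ ((1 / 2 + ε') * t') * (X.card : ℝ) <
                ((X.filter (fun σ => ∀ k, σ (I' k) = L' k)).card : ℝ) * (n.descFactorial t' : ℝ)) ∨
        (∃ J P : Fin t → Fin n, Function.Injective J ∧ Function.Injective P ∧
            Real.exp (c + 1) * ((S.card * T.card * U.card : ℕ) : ℝ) *
                (((n - t).factorial : ℝ) / (n.factorial : ℝ)) ^ ((3 : ℝ) / 2) ≤
              (((S.filter (fun σ => ∀ k, σ (I k) = L k)).card *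
                  (T.filter (fun σ => ∀ k, σ (J k) = L k)).card *
                  (U.filter (fun σ => ∀ k, σ (P k) = L k)).card : ℕ) : ℝ))) :
    ∀ ε : ℝ, 0 < ε → ∀ c : ℝ, 0 < c → ∃ ε' : ℝ, 0 < ε' ∧ ε' ≤ ε ∧ ∃ n₀ : ℕ, ∀ n ≥ n₀,
      ∀ S T U : Finset (Equiv.Perm (Fin n)), TripleProductProperty S T U →
      (n.factorial : ℝ) ^ ((3 : ℝ) / 2) * Real.exp (-(c * Real.sqrt (n : ℝ))) ≤
        ((S.card * T.card * U.card : ℕ) : ℝ) →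
      (∀ g ∉ T, ¬ TripleProductProperty S (insert g T) U) →
      (∀ g ∉ U, ¬ TripleProductProperty S T (insert g U)) →
      ∀ t : ℕ, 1 ≤ t → (t : ℝ) ≤ Real.sqrt (n : ℝ) →
      ((t : ℝ) < 2 * (n : ℝ) ^ ((1 - ε') / 2) ∨
        c * Real.sqrt (n : ℝ) / (ε' * Real.log (n : ℝ) + 2) < (t : ℝ)) →
      ∀ I L : Fin t → Fin n, Function.Injective I → Function.Injective L →
      (n : ℝ) ^ ((1 / 2 + ε) * t) * (S.card : ℝ) <
        ((S.filter (fun σ => ∀ k, σ (I k) = L k)).card : ℝ) * (n.descFactorial t : ℝ) →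
      (∃ X : Finset (Equiv.Perm (Fin n)), (X = S ∨ X = T ∨ X = U) ∧
          ∃ t' : ℕ, 1 ≤ t' ∧ (t' : ℝ) ≤ Real.sqrt (n : ℝ) ∧ 2 * (n : ℝ) ^ ((1 - ε') / 2) ≤ (t' : ℝ) ∧
            (t' : ℝ) ≤ c * Real.sqrt (n : ℝ) / (ε' * Real.log (n : ℝ) + 2) ∧
            ∃ I' L' : Fin t' → Fin n, Function.Injective I' ∧ Function.Injective L' ∧
              (n : ℝ) ^ ((1 / 2 + ε') * t') * (X.card : ℝ) <
                ((X.filter (fun σ => ∀ k, σ (I' k) = L' k)).card : ℝ) * (n.descFactorial t' : ℝ)) ∨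
        (∃ J P : Fin t → Fin n, Function.Injective J ∧ Function.Injective P ∧
            Real.exp (c + 1) * ((S.card * T.card * U.card : ℕ) : ℝ) *
                (((n - t).factorial : ℝ) / (n.factorial : ℝ)) ^ ((3 : ℝ) / 2) ≤
              (((S.filter (fun σ => ∀ k, σ (I k) = L k)).card *
                  (T.filter (fun σ => ∀ k, σ (J k) = L k)).card *
                  (U.filter (fun σ => ∀ k, σ (P k) = L k)).card : ℕ) : ℝ)) := by
  intro ε hε c hc
  obtain ⟨ε', hε', hε'ε, n₀, h⟩ := hdeep ε hε c hc
  refine ⟨ε', hε', hε'ε, n₀, ?_⟩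
  intro n hn S T U hTPP hLarge hsatM hsatR t ht1 htn hout I L hI hL hb
  by_cases hex : ∃ t' : ℕ, 1 ≤ t' ∧ (t' : ℝ) ≤ Real.sqrt (n : ℝ) ∧
      2 * (n : ℝ) ^ ((1 - ε') / 2) ≤ (t' : ℝ) ∧
      (t' : ℝ) ≤ c * Real.sqrt (n : ℝ) / (ε' * Real.log (n : ℝ) + 2) ∧
      ((t ≤ t' ∧ (1 / 2 + ε') * t' ≤ (1 / 2 + ε) * t) ∨
        (t' ≤ t ∧ (1 / 2 + ε') * t' + ((t : ℝ) - t') ≤ (1 / 2 + ε) * t))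
  · obtain ⟨t', h1, h2, h3, h4, h5⟩ := hex
    exact Or.inl (stub_bandRelocation_nearBand ε ε' c n S T U t I L hI hL hb t' h1 h2 h3 h4 h5)
  · exact h n hn S T U hTPP hLarge hsatM hsatR t ht1 htn hout
      (fun t' h1 h2 h3 h4 h5 => hex ⟨t', h1, h2, h3, h4, h5⟩) I L hI hL hb

end Summit.MatrixMultiplication.MatrixMultiplication.Theorems.JuntaBranch
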